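import Literature.AlgebraicGeometry.Resolution.GiraudNormalFormTransport
import Literature.AlgebraicGeometry.Resolution.RegularSystemOfParameters
import Mathlib.Algebra.CharP.Algebra
import Mathlib.Algebra.CharP.Lemmas
import Mathlib.Logic.Equiv.Fintype
import HarnessLib

/-!
# Stub `stub_looseCleanOfGiraudNormalFormAt` for crux stmt-ResolutionOfSingularities-15917
(`RadicialJung.CleanModels`)

Bridge to the sibling crux `PicoverLocalModel`: **Giraud normal form implies loose cleanness**.
Let `O` be a regular local domain of prime characteristic `p` with fraction field `K`, let
`t : Fin d → O` be a minimal generating system of `𝔪` (`d = dim O`) and `x_j := t_j` (`j < r`)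
the boundary equations. If `a ∈ O` is in Giraud normal form `GiraudNormalFormAt p x a`
(Literature `KummerNormalForm.lean`), then some representative `c₀^p + c₁^p a` (`c₁ ≠ 0`) of the
`K^p`-line of `a` is loosely clean.

Proof. All `t_j ≠ 0` (minimality of the generating system, `not_mem_span_image_of_not_mem`).
* Kummer exit `a = g^p + v ∏ x_j^{A_j}` (`v` a unit, some `p ∤ A_j`): with
  `y := ∏ x_j^{⌊A_j/p⌋}`, `c₁ := y⁻¹`, `c₀ := -g y⁻¹` one gets
  `c₀^p + c₁^p a = v ∏ x_j^{A_j mod p}`; re-enumerating `t` by a permutation `σ` of `Fin d`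
  which puts the `x_j` with `A_j mod p ≠ 0` first (`Equiv.Perm.exists_extending_pair`) this is
  the toroidal form `v ∏_{i<m} t'_i^{a'_i}` with all `a'_i ∈ (0, p)`.
* Wound/transversal exit `a = g^p + y^p u`, `y := ∏ x_j^{B_j}`: with `c₁ := y⁻¹`,
  `c₀ := -g y⁻¹` one gets `c₀^p + c₁^p a = u`; if `u - c^p ∉ 𝔪` for all `c` then `u` is a unit
  (`c = 0`) residually not a `p`-th power, and if `u - c^p ∈ 𝔪 ∖ (𝔪² + (x))` then a fortiori
  `u - c^p ∈ 𝔪 ∖ 𝔪²`.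
-/

noncomputable section

set_option linter.dupNamespace false

open IsLocalRing Literature.AlgebraicGeometry.Resolution

namespace Summit.ResolutionOfSingularities.ResolutionOfSingularities.Theorems.RadicialJung.CleanModels

universe u

/-- The Frobenius-twist computation in a ring `K` of prime characteristic `p`: if `c y = 1` then
`(-g c)^p + c^p (g^p + y^p b) = b`. -/
theorem neg_mul_pow_add_pow_mul_eq {K : Type*} [CommRing K] (p : ℕ) [Fact p.Prime] [CharP K p]
    (g y c b : K) (hc : c * y = 1) :
    (-g * c) ^ p + c ^ p * (g ^ p + y ^ p * b) = b := by
  rw [mul_pow, neg_pow, neg_one_pow_char K p, mul_add, ← mul_assoc (c ^ p) (y ^ p) b,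
    ← mul_pow c y p, hc, one_pow, one_mul]
  ring

/-- Members of a minimal generating system `t : Fin d → O` of the maximal ideal of a regular
local ring of dimension `d` are non-zero. -/
theorem rsop_apply_ne_zero {O : Type u} [CommRing O] [IsRegularLocalRing O] {d : ℕ}
    (t : Fin d → O) (ht : Ideal.span (Set.range t) = maximalIdeal O)
    (hd : ringKrullDim O = (d : WithBot ℕ∞)) (i : Fin d) : t i ≠ 0 := by
  have hd' : (maximalIdeal O).spanFinrank = d := by
    have h := IsRegularLocalRing.spanFinrank_maximalIdeal (R := O)
    rw [hd] at h
    exact_mod_cast h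
  intro h0
  refine not_mem_span_image_of_not_mem hd' t ht (Set.notMem_empty i) ?_
  rw [h0]
  exact Ideal.zero_mem _

/-- Re-enumeration of a product of powers supported on a finset `S` of indices: enumerating `S`
by `Fin S.card` (via `S.equivFin.symm`), the product of the `x_j ^ n_j` over the enumeration is
the full product `∏ j, x_j ^ n_j`, provided `n` vanishes off `S`. -/
theorem prod_pow_equivFin_symm_eq {M : Type*} [CommMonoid M] {r : ℕ} (S : Finset (Fin r))
    (x : Fin r → M) (n : Fin r → ℕ) (hn : ∀ j, j ∉ S → n j = 0) :
    ∏ i : Fin S.card, x (S.equivFin.symm i) ^ n (S.equivFin.symm i) = ∏ j, x j ^ n j := by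
  calc ∏ i : Fin S.card, x (S.equivFin.symm i) ^ n (S.equivFin.symm i)
      = ∏ j : S, x j ^ n j := Equiv.prod_comp S.equivFin.symm (fun j : S => x j ^ n j)
    _ = ∏ j ∈ S, x j ^ n j := Finset.prod_coe_sort S fun j => x j ^ n j
    _ = ∏ j, x j ^ n j :=
        Finset.prod_subset (Finset.subset_univ S) fun j _ hj => by rw [hn j hj, pow_zero]

/-- An enumeration of a finset `S ⊆ Fin r` by `Fin S.card`: an injective map onto `S` along which
products of powers supported on `S` re-enumerate. -/
theorem exists_enumeration {M : Type*} [CommMonoid M] {r : ℕ} (S : Finset (Fin r))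
    (x : Fin r → M) :
    ∃ emb : Fin S.card → Fin r, (∀ i, emb i ∈ S) ∧ Function.Injective emb ∧
      ∀ n : Fin r → ℕ, (∀ j, j ∉ S → n j = 0) →
        ∏ i : Fin S.card, x (emb i) ^ n (emb i) = ∏ j, x j ^ n j :=
  ⟨fun i => S.equivFin.symm i, fun i => (S.equivFin.symm i).2,
    Subtype.val_injective.comp S.equivFin.symm.injective,
    fun n hn => prod_pow_equivFin_symm_eq S x n hn⟩

/-- **Giraud normal form implies loose cleanness.** In a regular local domain `O` of prime
characteristic `p` with fraction field `K`, let `x : Fin r → O` be boundary equations which are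
part of a minimal generating system `(t_1..t_d)` of `𝔪` (`d = dim O`), and let `a ∈ O` be in
(intrinsic, boundary-adapted) Giraud normal form `GiraudNormalFormAt p x a`. Then some
representative `c₁^p a + c₀^p` (`c₁ ≠ 0`) of the `K^p`-line of `a` is loosely clean: toroidal
`u ∏_{i<m} t'_i^{a'_i}` for a re-enumerated minimal generating system `t'` with all `p ∤ a'_i`,
or a unit residually not a `p`-th power, or `c^p +` (an element of `𝔪 ∖ 𝔪²`). -/
theorem stub_looseCleanOfGiraudNormalFormAt {O K : Type u} [CommRing O] [IsRegularLocalRing O]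
    [IsDomain O] [Field K] [Algebra O K] [IsFractionRing O K] (p : ℕ) (hp : p.Prime) [CharP O p]
    {d r : ℕ} (hrd : r ≤ d) (t : Fin d → O) (ht : Ideal.span (Set.range t) = maximalIdeal O)
    (hd : ringKrullDim O = (d : WithBot ℕ∞)) (a : O)
    (ha : GiraudNormalFormAt p (fun j : Fin r => t (Fin.castLE hrd j)) a) :
    ∃ c₀ c₁ : K, c₁ ≠ 0 ∧
      ((∃ (d' m : ℕ) (hmd : m ≤ d') (t' : Fin d' → O) (a' : Fin m → ℕ) (u : O), IsUnit u ∧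
          Ideal.span (Set.range t') = maximalIdeal O ∧
          ringKrullDim O = (d' : WithBot ℕ∞) ∧ 0 < m ∧ (∀ i, ¬ p ∣ a' i) ∧
          c₀ ^ p + c₁ ^ p * algebraMap O K a =
            algebraMap O K (u * ∏ i : Fin m, t' (Fin.castLE hmd i) ^ (a' i))) ∨
        (∃ u : O, IsUnit u ∧ c₀ ^ p + c₁ ^ p * algebraMap O K a = algebraMap O K u ∧
          ∀ c : O, u - c ^ p ∉ maximalIdeal O) ∨
        (∃ s c : O, c₀ ^ p + c₁ ^ p * algebraMap O K a = algebraMap O K s ∧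
          s - c ^ p ∈ maximalIdeal O ∧ s - c ^ p ∉ maximalIdeal O ^ 2)) := by
  classical
  haveI : Fact p.Prime := ⟨hp⟩
  haveI : CharP K p := charP_of_injective_algebraMap (IsFractionRing.injective O K) p
  set x : Fin r → O := fun j => t (Fin.castLE hrd j) with hx
  have hxne : ∀ j, algebraMap O K (x j) ≠ 0 := fun j =>
    (map_ne_zero_iff _ (IsFractionRing.injective O K)).mpr (rsop_apply_ne_zero t ht hd _)
  have hprodne : ∀ n : Fin r → ℕ, algebraMap O K (∏ j, x j ^ n j) ≠ 0 := fun n => by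
    rw [map_prod]
    exact Finset.prod_ne_zero_iff.mpr fun j _ => by rw [map_pow]; exact pow_ne_zero _ (hxne j)
  rcases ha with ⟨g, u, B, hu, hag⟩ | ⟨g, A, v, ⟨j₀, hj₀⟩, hag⟩
  · -- wound / transversal exit: `a = g^p + y^p u`, `y = ∏ x_j^{B_j}`
    have hyK := hprodne B
    set y : O := ∏ j, x j ^ B j with hy
    refine ⟨-(algebraMap O K g) * (algebraMap O K y)⁻¹, (algebraMap O K y)⁻¹, inv_ne_zero hyK,
      Or.inr ?_⟩
    have heq : (-(algebraMap O K g) * (algebraMap O K y)⁻¹) ^ p +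
        ((algebraMap O K y)⁻¹) ^ p * algebraMap O K a = algebraMap O K u := by
      have ha' : algebraMap O K a =
          algebraMap O K g ^ p + algebraMap O K y ^ p * algebraMap O K u := by
        rw [hag]; simp only [map_add, map_mul, map_pow]
      rw [ha']
      exact neg_mul_pow_add_pow_mul_eq p _ _ _ _ (inv_mul_cancel₀ hyK)
    rcases hu with hw | ⟨c, hc, hc2⟩
    · refine Or.inl ⟨u, ?_, heq, hw⟩
      by_contra hnu
      refine hw 0 ?_
      rw [zero_pow hp.ne_zero, sub_zero]
      exact (IsLocalRing.mem_maximalIdeal _).mpr (mem_nonunits_iff.mpr hnu)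
    · exact Or.inr ⟨u, c, heq, hc, fun h => hc2 (Ideal.mem_sup_left h)⟩
  · -- Kummer exit: `a = g^p + v ∏ x_j^{A_j}`; divide by `y^p`, `y = ∏ x_j^{⌊A_j/p⌋}`
    have hyK := hprodne fun j => A j / p
    set y : O := ∏ j, x j ^ (A j / p) with hy
    have hprod : ∏ j, x j ^ A j = y ^ p * ∏ j, x j ^ (A j % p) := by
      rw [hy, ← Finset.prod_pow, ← Finset.prod_mul_distrib]
      refine Finset.prod_congr rfl fun j _ => ?_
      rw [← pow_mul, ← pow_add, Nat.div_add_mod']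
    refine ⟨-(algebraMap O K g) * (algebraMap O K y)⁻¹, (algebraMap O K y)⁻¹, inv_ne_zero hyK,
      Or.inl ?_⟩
    have heq : (-(algebraMap O K g) * (algebraMap O K y)⁻¹) ^ p +
        ((algebraMap O K y)⁻¹) ^ p * algebraMap O K a =
          algebraMap O K ((v : O) * ∏ j, x j ^ (A j % p)) := by
      have ha' : algebraMap O K a = algebraMap O K g ^ p +
          algebraMap O K y ^ p * algebraMap O K ((v : O) * ∏ j, x j ^ (A j % p)) := by
        rw [hag, hprod]; simp only [map_add, map_mul, map_pow]; ring
      rw [ha']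
      exact neg_mul_pow_add_pow_mul_eq p _ _ _ _ (inv_mul_cancel₀ hyK)
    -- re-enumerate the minimal generating system: the `x_j` with `A_j % p ≠ 0` first
    set S : Finset (Fin r) := Finset.univ.filter fun j => A j % p ≠ 0 with hS
    have hj₀S : j₀ ∈ S :=
      Finset.mem_filter.mpr ⟨Finset.mem_univ _, fun h => hj₀ (Nat.dvd_of_mod_eq_zero h)⟩
    have hoff : ∀ j, j ∉ S → A j % p = 0 := fun j hj => by
      by_contra h
      exact hj (Finset.mem_filter.mpr ⟨Finset.mem_univ _, h⟩)
    have hmd : S.card ≤ d := ((Finset.card_le_univ S).trans (Fintype.card_fin r).le).trans hrd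
    obtain ⟨emb, hembS, hembinj, hembprod⟩ := exists_enumeration S x
    obtain ⟨σ, hσ⟩ := Equiv.Perm.exists_extending_pair (Fin.castLE hmd)
      (fun i => Fin.castLE hrd (emb i)) (Fin.castLE_injective hmd)
      ((Fin.castLE_injective hrd).comp hembinj)
    have hre : ∏ i : Fin S.card, (t ∘ σ) (Fin.castLE hmd i) ^ (A (emb i) % p) =
        ∏ j, x j ^ (A j % p) := by
      rw [← hembprod (fun j => A j % p) hoff]
      exact Finset.prod_congr rfl fun i _ => by rw [Function.comp_apply, hσ]
    refine ⟨d, S.card, hmd, t ∘ σ, fun i => A (emb i) % p, v, v.isUnit, ?_, hd,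
      Finset.card_pos.mpr ⟨j₀, hj₀S⟩, fun i => ?_, by rw [heq, hre]⟩
    · rw [Set.range_comp, σ.surjective.range_eq, Set.image_univ, ht]
    · exact Nat.not_dvd_of_pos_of_lt (Nat.pos_of_ne_zero (Finset.mem_filter.mp (hembS i)).2)
        (Nat.mod_lt _ hp.pos)

end Summit.ResolutionOfSingularities.ResolutionOfSingularities.Theorems.RadicialJung.CleanModels

end
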